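import Literature.AnabelianGeometry.EtaleTheta.Discharge.Sec3Cor38OfGaloisCoveringConnected
import Literature.AnabelianGeometry.EtaleTheta.Discharge.Sec3Cor38OfRankOnePoint
import Literature.AnabelianGeometry.EtaleTheta.Discharge.Sec3Prop34ConstOneComp
import Literature.AnabelianGeometry.EtaleTheta.Discharge.Sec3Prop34ConstTateTower
import Literature.AnabelianGeometry.EtaleTheta.Discharge.Sec3BLambdaInjectiveOfGaloisCoveringConnected
import Literature.AnabelianGeometry.EtaleTheta.TemperedFrobenioidOfGaloisCoveringRankOnePointR
import HarnessLib

/-!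
# [EtTh] Corollary 3.8 (i) and (ii) AS TYPED, MONOID TYPE `Λ = ℝ`, for tempered Frobenioids with print's divisor monoid over the
# CONSTRUCTED Def. 3.3 (iii) data of the connected coverings (`ofRlfRWeak`), at rank-one points, at the Tate tower and
# UNCONDITIONALLY at the one-component model

S. Mochizuki, *The étale theta function and its Frobenioid-theoretic manifestations*, Publ. RIMS **45** (2009), Cor. 3.8
(i)/(ii), statement PDF p. 80, proof pp. 81–82 [cite: MochizukiEtTh2009, Cor 3.8 p.80]; Def. 3.3 (iii) p. 73, Rmk. 3.3.1 p. 73,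
Prop. 3.4 (ii) p. 74, Def. 3.6 (i)/(ii) pp. 76–77 ("`B₀^ℝ := ℝ·Φ₀^birat`, `F₀^ℝ := ℝ·Φ₀^cnst`"), Ex. 3.9 (iii) p. 84;
S. Mochizuki, *The geometry of Frobenioids I* (2008), Thm. 5.2 (ii) p. 100 [cite: MochizukiFrdI2008, Thm. 5.2(ii) p.100].

abc-iut cell, layer L2, cone nodes `EtTh:Cor3.8(i)` / `EtTh:Cor3.8(ii)`, seat abc-iut-L2-d2 (gen 5).  PROOF-ONLY (0 definitions) — the
`Λ = ℝ` twin of this seat's `Sec3Cor38OfGaloisCoveringConnected.lean` (p449574) and `Sec3Cor38OfRankOnePoint.lean` (p449948), over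
abc-iut-L6-t12's weak `ℝ`-realified data `ofRlfRWeak (DivisorMonoids.ofGaloisActionConnected A hZ) hpf` (abc-iut-w6-d058's constructed
Def. 3.3 (iii) data) and abc-iut-w6-d048's `ℝ`-engine `TemperedFrobenioid.ofRankOnePointR` (p447026).  The `Λ`-generic weak closers
`Cor38Hyp.cor38_i_weak_of_coord` (abc-iut-w6-d039) / `cor38_ii_weak_of_coord` (abc-iut-L1-t12) take, per side, `hF` · `hP34Λ` · `hNZ` ·
`hQ` · [`hFinv`]; at monoid type `ℝ`:

* `hP34Λ` ⟸ **`hE`**, the `Λ = ℝ` effective-locus clause of Prop. 3.4 (ii) over ALL connected coverings `Y` (census A2, GAP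
  G-w5d130-1: "an element of `ℝ·Φ₀^birat(Y)` with effective image lies in `ℝ·Φ₀^cnst(Y)`") — a NAMED binder at the generic data and at
  the Tate tower (abc-iut-w6-d061's `thm37_ofRankOnePointR_of_inputs` keeps the same binder), a THEOREM at the one-component model
  (`OneCompFrd.effRealSpan_dm`: all functions are constant, `Φ₀^birat = Φ₀^cnst`);
* `hFinv` UNCONDITIONAL (abc-iut-L6-t12's `ofRlfRWeak_hFinv'`: `F₀^ℝ` is a group);
* `hQ` ⟸ (hZQ) at every `Φ₀(Y)` (abc-iut-w6-d057's `isZMonoprime_submonoid_primes_phiZero`, via p449574's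
  `isZQMonoprime_primes_Φ₀_ofGaloisActionConnected`) + (hsat) from the Φ-tie `Φ(B) = ι(Φ₀(Y_B)^pf)` — `hQ_of_eq_mrange_weakR`;
* `hNZ` ⟸ abc-iut-L2-t3's `Prop34Const` (abc-iut-L6-t12's `exists_cnstFn_effective_ofRlfRWeak_of_prop34Const`) at the generic data, and
  CONSTRUCTED at rank-one points from abc-iut-w6-d048's `RankOnePoint.cnstFnR` (`exists_cnstFn_effective_ofRankOnePointR`);
* `hF`: binder (§2), ⟸ `IsOfFSMType D` (§3), unconditional at `B^temp(Π)⁰` (§4) — abc-iut-w6-d048's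
  `isFrobenioid_ofRlfRWeak_ofGaloisActionConnected_{of_isOfFSMType, connectedPart_bTemp}`.

RESULTS: `Cor38Hyp.cor38_i/ii_ofGaloisActionConnectedR_{of_isFrobenioid, of_isOfFSMType, connectedPart_bTemp}_of_eq_mrange` (residual:
`hE_i`, `Prop34Const_i`, Φ-ties [, `IsOfFSMType D_i`]); `TemperedFrobenioid.cor38_i/ii_ofRankOnePointR (h) (hE hE′)`; at the MODEL OF
RECORD `TateTowerFrd.cor38_i/ii_temperedFrobenioidR (h) (hE)` (residual: the tower's `hE` ONLY); and **`OneCompFrd.cor38_i/ii_temperedFrobenioidR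
(h)` with NO binder** (`hE` proved: `OneCompFrd.effRealSpan_dm` — `Φ₀^birat = Φ₀^cnst` at every connected covering).

HONEST LABEL: instantiation / consistency certificates over GENUINE vocabularies and CONSTRUCTED data; `hE` and `Prop34Const` are
properties of the geometric data, binders where not proved; refereed pre-IUT material; nothing here bears on [IUTchIII] Cor. 3.12; no
side taken; typed ≠ proved — here proved modulo the displayed named binders.
-/

noncomputable section

namespace Literature.AnabelianGeometry.EtaleTheta

open CategoryTheory Opposite Function Literature.AlgebraicGeometry.Frobenioids Literature.AnabelianGeometry.SemiGraphs
  LogDivisorModel LogDivisorModel.GaloisAction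

universe u u' v'

/-! ## §1 The print-level inputs at the `ℝ`-realified constructed connected data -/

namespace TemperedFrobenioid

section InputsR

variable {Z : LogDivisorModel.{u}} {G : Type u} [Group G] (A : Z.GaloisAction G) (hZ : Z.CuspLaws)
  (hpf : ∀ Y : ((isConnectedGSet (G := G)).FullSubcategory)ᵒᵖ,
    IsPerfFactorialCof ((DivisorMonoids.ofGaloisActionConnected A hZ).Φ₀.obj Y))

/-- **`hP34Λ` at monoid type `ℝ` ⟸ the `Λ = ℝ` effective-locus clause `hE`** (Prop. 3.4 (ii) clause 1 for `B₀^ℝ = ℝ·Φ₀^birat`,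
`F₀^ℝ = ℝ·Φ₀^cnst`; exactly the first field of abc-iut-L6-t12's `Prop34Cnst.ofRlfRWeak_of_eff`). [cite: MochizukiEtTh2009, Prop 3.4 (ii) p.74] -/
theorem hP34Λ_ofGaloisActionConnected_weakR
    (hE : ∀ (Y : (isConnectedGSet (G := G)).FullSubcategory)
      (b : Algebra.GrothendieckGroup
        ((RealifiedDivisorMonoids.realDataWeak (DivisorMonoids.ofGaloisActionConnected A hZ) hpf).rlf.obj (op Y)))
      (x : (hpf (op Y)).weak.Rlf),
      b ∈ ((RealifiedDivisorMonoids.realDataWeak (DivisorMonoids.ofGaloisActionConnected A hZ) hpf).realSpan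
        (DivisorMonoids.ofGaloisActionConnected A hZ).biratGp).carrier Y →
      b = Algebra.GrothendieckGroup.of x →
      b ∈ ((RealifiedDivisorMonoids.realDataWeak (DivisorMonoids.ofGaloisActionConnected A hZ) hpf).realSpan
        (DivisorMonoids.ofGaloisActionConnected A hZ).cnstGp).carrier Y)
    (Y : ((isConnectedGSet (G := G)).FullSubcategory)ᵒᵖ)
    (b : (RealifiedDivisorMonoids.ofRlfRWeak (DivisorMonoids.ofGaloisActionConnected A hZ) hpf).BΛ.obj Y)
    (r : (RealifiedDivisorMonoids.ofRlfRWeak (DivisorMonoids.ofGaloisActionConnected A hZ) hpf).ΦR.obj Y)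
    (h : (RealifiedDivisorMonoids.ofRlfRWeak (DivisorMonoids.ofGaloisActionConnected A hZ) hpf).divΛ Y b =
      Algebra.GrothendieckGroup.of r) :
    b ∈ (RealifiedDivisorMonoids.ofRlfRWeak (DivisorMonoids.ofGaloisActionConnected A hZ) hpf).FΛ Y :=
  hE (unop Y) b.1 r b.2 h

variable {A hZ hpf} {D : Type u'} [Category.{v'} D] {VD : FrdICatStub.{u', v', u} D}
  (C : TemperedFrobenioid (RealifiedDivisorMonoids.ofRlfRWeak (DivisorMonoids.ofGaloisActionConnected A hZ) hpf) D VD)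

/-- **(hsat) from the Φ-tie, monoid type `ℝ`** (the map `Φ₀ → Φ₀^ℝ` of `ofRlfRWeak` is that of `ofRlfZWeak`): every `x ∈ Φ(B) =
ι(Φ₀(Y_B)^pf)` has a power in the image of `Φ₀(Y_B)`. [cite: MochizukiEtTh2009, Ex 3.9 p.84] -/
theorem ratSupport_of_eq_mrange_weakR
    (hΦ : ∀ B : Dᵒᵖ, C.Φ.carrier B = MonoidHom.mrange (hpf (C.baseOp B)).weak.toRealification) (W : D) :
    ∀ x ∈ C.Φ.carrier (op W),
      ∃ (N : ℕ+) (d : (DivisorMonoids.ofGaloisActionConnected A hZ).Φ₀.obj (C.baseOp (op W))),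
        x ^ (N : ℕ) = (RealifiedDivisorMonoids.ofRlfRWeak (DivisorMonoids.ofGaloisActionConnected A hZ) hpf).toR
          (C.baseOp (op W)) d := by
  intro x hx
  rw [hΦ] at hx
  obtain ⟨a, rfl⟩ := hx
  obtain ⟨⟨c, n⟩, rfl⟩ := Perfection.mk_surjective a
  refine ⟨n, c, ?_⟩
  change (hpf _).weak.toRealification (Perfection.mk c n) ^ (n : ℕ) = (hpf _).weak.toRealification (Perfection.of _ c)
  rw [← map_pow, Perfection.mk_pow_self]

/-- **`hQ` (row C38-L05, GAP G-w4d084-3) is a THEOREM for every tempered Frobenioid of monoid type `ℝ` with print's `Φ` over the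
constructed connected data** (abc-iut-L6-t12's `isQMonoprime_pfAt_divisorMonoid_of_ratSupport_weak`; (hZQ) at every `Φ₀(Y)` by
p449574's `isZQMonoprime_primes_Φ₀_ofGaloisActionConnected`). [cite: MochizukiEtTh2009, Def 3.6 p.77] -/
theorem hQ_of_eq_mrange_weakR
    (CR : TemperedFrobenioid (RealifiedDivisorMonoids.ofRlfRWeak (DivisorMonoids.ofGaloisActionConnected A hZ) hpf) D VD)
    (hΦ : ∀ B : Dᵒᵖ, CR.Φ.carrier B = MonoidHom.mrange (hpf (CR.baseOp B)).weak.toRealification) (W : D)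
    (𝔮 : Primes (Perfection (CR.divisorMonoid.obj (op W)))) : IsQMonoprime (PfAt (CR.divisorMonoid.obj (op W)) 𝔮) :=
  isQMonoprime_pfAt_divisorMonoid_of_ratSupport_weak W
    (fun 𝔭 => isZQMonoprime_primes_Φ₀_ofGaloisActionConnected A hZ _ 𝔭) (CR.ratSupport_of_eq_mrange_weakR hΦ W) 𝔮

end InputsR

/-! ## §2 Rank-one points, monoid type `ℝ`: `hNZ` constructed, `hQ` from `Φ₀(S₀) ≅ ℕ` -/

section RankOneR

variable {Z : LogDivisorModel.{0}} {G : Type} [Group G] {A : Z.GaloisAction G} (hZ : Z.CuspLaws) (P : RankOnePoint A)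
  (hpf : ∀ Y : ((isConnectedGSet (G := G)).FullSubcategory)ᵒᵖ,
    IsPerfFactorialCof ((DivisorMonoids.ofGaloisActionConnected A hZ).Φ₀.obj Y))
  (R S : ((Discrete PUnit.{1})ᵒᵖ ⥤ CommMonCat.{0}) → Prop)

/-- `Φ` of the `ℝ`-witness at a rank-one point is `im(Φ₀(S₀)^pf → Φ₀(S₀)^rlf)` (the Φ-tie, `rfl`). [cite: MochizukiEtTh2009, Def 3.6 p.77] -/
theorem ofRankOnePointR_Φ_eq_mrange (B : (Discrete PUnit.{1})ᵒᵖ) :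
    (ofRankOnePointR hZ P hpf R S).Φ.carrier B = MonoidHom.mrange (hpf ((ofRankOnePointR hZ P hpf R S).baseOp B)).weak.toRealification :=
  rfl

/-- **`hQ` OUTRIGHT at the `ℝ`-witness of a rank-one point.** [cite: MochizukiEtTh2009, Def 3.6 p.77] -/
theorem hQ_ofRankOnePointR (W : Discrete PUnit.{1})
    (𝔮 : Primes (Perfection ((ofRankOnePointR hZ P hpf R S).divisorMonoid.obj (op W)))) :
    IsQMonoprime (PfAt ((ofRankOnePointR hZ P hpf R S).divisorMonoid.obj (op W)) 𝔮) :=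
  (ofRankOnePointR hZ P hpf R S).hQ_of_eq_mrange_weakR (ofRankOnePointR_Φ_eq_mrange hZ P hpf R S) W 𝔮

/-- **`hNZ` at monoid type `ℝ` — Def. 3.6 (ii)(b), bracketed sentence — CONSTRUCTED at a rank-one point**: abc-iut-w6-d048's constant
`ι(div₀ b₁) ∈ F₀^ℝ(S₀)` (`RankOnePoint.cnstFnR`, `cnstFnR_mem_FΛ`) attached to the generator `e⁻¹ 1`, paired with the class of `ι(e⁻¹ 1) ∈ Φ`
(`divΛ_cnstFnR`), which is `≠ 1`. [cite: MochizukiEtTh2009, Def 3.6 p.77] -/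
theorem exists_cnstFn_effective_ofRankOnePointR (X : (Discrete PUnit.{1})ᵒᵖ) :
    ∃ u : ((RankOnePoint.TR hZ hpf).BΛ.obj ((ofRankOnePointR hZ P hpf R S).baseOp X) : Type) ×
        Algebra.GrothendieckGroup ((ofRankOnePointR hZ P hpf R S).Φ.carrier X),
      u ∈ (ofRankOnePointR hZ P hpf R S).cnstFn X ∧
        ∃ x : (ofRankOnePointR hZ P hpf R S).Φ.carrier X, x ≠ 1 ∧ u.2 = Algebra.GrothendieckGroup.of x := by
  let x : (ofRankOnePointR hZ P hpf R S).Φ.carrier X :=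
    ⟨(hpf (op P.S₀)).weak.toRealification (Perfection.of _ (P.e.symm (Multiplicative.ofAdd 1))), ⟨_, rfl⟩⟩
  have hrat : ((P.cnstFnR hZ hpf (P.e.symm (Multiplicative.ofAdd 1)), Algebra.GrothendieckGroup.of x) :
      ((RankOnePoint.TR hZ hpf).BΛ.obj ((ofRankOnePointR hZ P hpf R S).baseOp X) : Type) ×
        Algebra.GrothendieckGroup ((ofRankOnePointR hZ P hpf R S).Φ.carrier X)) ∈
      (ofRankOnePointR hZ P hpf R S).ratFn X := by
    change (RankOnePoint.TR hZ hpf).divΛ (op P.S₀) (P.cnstFnR hZ hpf (P.e.symm (Multiplicative.ofAdd 1))) =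
      (ofRankOnePointR hZ P hpf R S).ΦgpToRlog X (Algebra.GrothendieckGroup.of x)
    rw [RankOnePoint.divΛ_cnstFnR, TemperedFrobenioid.ΦgpToRlog, EtaleTheta.gpMap_of, EtaleTheta.gpMap_of]
    rfl
  refine ⟨(P.cnstFnR hZ hpf (P.e.symm (Multiplicative.ofAdd 1)), Algebra.GrothendieckGroup.of x),
    Submonoid.mem_inf.2 ⟨hrat, P.cnstFnR_mem_FΛ hZ hpf _⟩, x, fun h => ?_, rfl⟩
  exact P.toRealification_gen_ne_one hZ hpf (congrArg Subtype.val h)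

end RankOneR

end TemperedFrobenioid

namespace Cor38Hyp

/-! ## §3 The generic `ℝ`-realified connected data: any category vocabulary / FSM-type bases / genuine bases -/

section ConnectedR

variable {Z : LogDivisorModel.{u}} {G : Type u} [Group G] {A : Z.GaloisAction G} {hZ : Z.CuspLaws}
  {hpf : ∀ Y : ((isConnectedGSet (G := G)).FullSubcategory)ᵒᵖ,
    IsPerfFactorialCof ((DivisorMonoids.ofGaloisActionConnected A hZ).Φ₀.obj Y)}
  {Z' : LogDivisorModel.{u}} {G' : Type u} [Group G'] {A' : Z'.GaloisAction G'} {hZ' : Z'.CuspLaws}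
  {hpf' : ∀ Y : ((isConnectedGSet (G := G')).FullSubcategory)ᵒᵖ,
    IsPerfFactorialCof ((DivisorMonoids.ofGaloisActionConnected A' hZ').Φ₀.obj Y)}
  {D : Type u'} [Category.{v'} D] {VD : FrdICatStub.{u', v', u} D}
  {D' : Type u'} [Category.{v'} D'] {VD' : FrdICatStub.{u', v', u} D'}
  {C₁ : TemperedFrobenioid
    (RealifiedDivisorMonoids.ofRlfRWeak (DivisorMonoids.ofGaloisActionConnected A hZ) hpf) D VD}
  {C₂ : TemperedFrobenioid
    (RealifiedDivisorMonoids.ofRlfRWeak (DivisorMonoids.ofGaloisActionConnected A' hZ') hpf') D' VD'}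

/-- **[EtTh] Cor. 3.8 (i) AS TYPED, monoid type `ℝ`, for tempered Frobenioids with print's `Φ` over the constructed connected data,
ANY category vocabularies**: residual `h`, `hF_i`, `hE_i`, `Prop34Const_i`, the Φ-ties. [cite: MochizukiEtTh2009, Cor 3.8 p.80] -/
theorem cor38_i_ofGaloisActionConnectedR_of_isFrobenioid_of_eq_mrange (h : Cor38Hyp C₁ C₂)
    (hF₁ : PreFrobenioid.IsFrobenioid C₁.toElem) (hF₂ : PreFrobenioid.IsFrobenioid C₂.toElem)
    (hE₁ : ∀ (Y : (isConnectedGSet (G := G)).FullSubcategory)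
      (b : Algebra.GrothendieckGroup
        ((RealifiedDivisorMonoids.realDataWeak (DivisorMonoids.ofGaloisActionConnected A hZ) hpf).rlf.obj (op Y)))
      (x : (hpf (op Y)).weak.Rlf),
      b ∈ ((RealifiedDivisorMonoids.realDataWeak (DivisorMonoids.ofGaloisActionConnected A hZ) hpf).realSpan
        (DivisorMonoids.ofGaloisActionConnected A hZ).biratGp).carrier Y →
      b = Algebra.GrothendieckGroup.of x →
      b ∈ ((RealifiedDivisorMonoids.realDataWeak (DivisorMonoids.ofGaloisActionConnected A hZ) hpf).realSpan
        (DivisorMonoids.ofGaloisActionConnected A hZ).cnstGp).carrier Y)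
    (hE₂ : ∀ (Y : (isConnectedGSet (G := G')).FullSubcategory)
      (b : Algebra.GrothendieckGroup
        ((RealifiedDivisorMonoids.realDataWeak (DivisorMonoids.ofGaloisActionConnected A' hZ') hpf').rlf.obj (op Y)))
      (x : (hpf' (op Y)).weak.Rlf),
      b ∈ ((RealifiedDivisorMonoids.realDataWeak (DivisorMonoids.ofGaloisActionConnected A' hZ') hpf').realSpan
        (DivisorMonoids.ofGaloisActionConnected A' hZ').biratGp).carrier Y →
      b = Algebra.GrothendieckGroup.of x →
      b ∈ ((RealifiedDivisorMonoids.realDataWeak (DivisorMonoids.ofGaloisActionConnected A' hZ') hpf').realSpan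
        (DivisorMonoids.ofGaloisActionConnected A' hZ').cnstGp).carrier Y)
    (hΦ₁ : ∀ B : Dᵒᵖ, C₁.Φ.carrier B = MonoidHom.mrange (hpf (C₁.baseOp B)).weak.toRealification)
    (hΦ₂ : ∀ B : D'ᵒᵖ, C₂.Φ.carrier B = MonoidHom.mrange (hpf' (C₂.baseOp B)).weak.toRealification)
    (hC₁ : (DivisorMonoids.ofGaloisActionConnected A hZ).Prop34Const)
    (hC₂ : (DivisorMonoids.ofGaloisActionConnected A' hZ').Prop34Const) :
    Literature.AnabelianGeometry.EtaleTheta.Cor38_i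
      (fun E _ => Literature.AlgebraicGeometry.Frobenioids.IsFrobeniusSlim E) h :=
  h.cor38_i_weak_of_coord hF₁ hF₂ (TemperedFrobenioid.hP34Λ_ofGaloisActionConnected_weakR A hZ hpf hE₁)
    (C₁.exists_cnstFn_effective_ofRlfRWeak_of_prop34Const hC₁) (C₁.hQ_of_eq_mrange_weakR hΦ₁)
    (TemperedFrobenioid.hP34Λ_ofGaloisActionConnected_weakR A' hZ' hpf' hE₂)
    (C₂.exists_cnstFn_effective_ofRlfRWeak_of_prop34Const hC₂) (C₂.hQ_of_eq_mrange_weakR hΦ₂)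

/-- **[EtTh] Cor. 3.8 (ii) AS TYPED, monoid type `ℝ`, same data and residual** (`hFinv_i` UNCONDITIONAL: abc-iut-L6-t12's
`ofRlfRWeak_hFinv'`). [cite: MochizukiEtTh2009, Cor 3.8 p.81] -/
theorem cor38_ii_ofGaloisActionConnectedR_of_isFrobenioid_of_eq_mrange (h : Cor38Hyp C₁ C₂)
    (hF₁ : PreFrobenioid.IsFrobenioid C₁.toElem) (hF₂ : PreFrobenioid.IsFrobenioid C₂.toElem)
    (hE₁ : ∀ (Y : (isConnectedGSet (G := G)).FullSubcategory)
      (b : Algebra.GrothendieckGroup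
        ((RealifiedDivisorMonoids.realDataWeak (DivisorMonoids.ofGaloisActionConnected A hZ) hpf).rlf.obj (op Y)))
      (x : (hpf (op Y)).weak.Rlf),
      b ∈ ((RealifiedDivisorMonoids.realDataWeak (DivisorMonoids.ofGaloisActionConnected A hZ) hpf).realSpan
        (DivisorMonoids.ofGaloisActionConnected A hZ).biratGp).carrier Y →
      b = Algebra.GrothendieckGroup.of x →
      b ∈ ((RealifiedDivisorMonoids.realDataWeak (DivisorMonoids.ofGaloisActionConnected A hZ) hpf).realSpan
        (DivisorMonoids.ofGaloisActionConnected A hZ).cnstGp).carrier Y)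
    (hE₂ : ∀ (Y : (isConnectedGSet (G := G')).FullSubcategory)
      (b : Algebra.GrothendieckGroup
        ((RealifiedDivisorMonoids.realDataWeak (DivisorMonoids.ofGaloisActionConnected A' hZ') hpf').rlf.obj (op Y)))
      (x : (hpf' (op Y)).weak.Rlf),
      b ∈ ((RealifiedDivisorMonoids.realDataWeak (DivisorMonoids.ofGaloisActionConnected A' hZ') hpf').realSpan
        (DivisorMonoids.ofGaloisActionConnected A' hZ').biratGp).carrier Y →
      b = Algebra.GrothendieckGroup.of x →
      b ∈ ((RealifiedDivisorMonoids.realDataWeak (DivisorMonoids.ofGaloisActionConnected A' hZ') hpf').realSpan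
        (DivisorMonoids.ofGaloisActionConnected A' hZ').cnstGp).carrier Y)
    (hΦ₁ : ∀ B : Dᵒᵖ, C₁.Φ.carrier B = MonoidHom.mrange (hpf (C₁.baseOp B)).weak.toRealification)
    (hΦ₂ : ∀ B : D'ᵒᵖ, C₂.Φ.carrier B = MonoidHom.mrange (hpf' (C₂.baseOp B)).weak.toRealification)
    (hC₁ : (DivisorMonoids.ofGaloisActionConnected A hZ).Prop34Const)
    (hC₂ : (DivisorMonoids.ofGaloisActionConnected A' hZ').Prop34Const) :
    Literature.AnabelianGeometry.EtaleTheta.Cor38_ii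
      (fun E _ Φ => ∀ (B : E) (α : Aut (Over.forget B)),
        (∀ (B' : Over B) (x : Φ.obj (op B'.left)),
          Literature.AlgebraicGeometry.Frobenioids.pull Φ (α.hom.app B') x = x) → α = 1) h :=
  h.cor38_ii_weak_of_coord hF₁ hF₂ (TemperedFrobenioid.hP34Λ_ofGaloisActionConnected_weakR A hZ hpf hE₁)
    (C₁.exists_cnstFn_effective_ofRlfRWeak_of_prop34Const hC₁) (C₁.hQ_of_eq_mrange_weakR hΦ₁)
    (RealifiedDivisorMonoids.ofRlfRWeak_hFinv' _ hpf)
    (TemperedFrobenioid.hP34Λ_ofGaloisActionConnected_weakR A' hZ' hpf' hE₂)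
    (C₂.exists_cnstFn_effective_ofRlfRWeak_of_prop34Const hC₂) (C₂.hQ_of_eq_mrange_weakR hΦ₂)
    (RealifiedDivisorMonoids.ofRlfRWeak_hFinv' _ hpf')

end ConnectedR

end Cor38Hyp

/-! ## §4 Rank-one points, monoid type `ℝ`: residual `hE` only; Tate tower; one-component model UNCONDITIONAL -/

namespace TemperedFrobenioid

section RankOnePairR

variable {Z : LogDivisorModel.{0}} {G : Type} [Group G] {A : Z.GaloisAction G} (hZ : Z.CuspLaws) (P : RankOnePoint A)
  (hpf : ∀ Y : ((isConnectedGSet (G := G)).FullSubcategory)ᵒᵖ,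
    IsPerfFactorialCof ((DivisorMonoids.ofGaloisActionConnected A hZ).Φ₀.obj Y))
  (R S : ((Discrete PUnit.{1})ᵒᵖ ⥤ CommMonCat.{0}) → Prop)
  {Z' : LogDivisorModel.{0}} {G' : Type} [Group G'] {A' : Z'.GaloisAction G'} (hZ' : Z'.CuspLaws)
  (P' : RankOnePoint A')
  (hpf' : ∀ Y : ((isConnectedGSet (G := G')).FullSubcategory)ᵒᵖ,
    IsPerfFactorialCof ((DivisorMonoids.ofGaloisActionConnected A' hZ').Φ₀.obj Y))
  (R' S' : ((Discrete PUnit.{1})ᵒᵖ ⥤ CommMonCat.{0}) → Prop)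

/-- **[EtTh] Cor. 3.8 (i) ∧ (ii) AS TYPED, monoid type `ℝ`, at the rank-one-point `ℝ`-witnesses**, residual = the `Λ = ℝ` effective-locus
clauses `hE`, `hE′` of the two models ONLY (`hF` by the FSM-type one-point base, `hNZ` constructed, `hQ` from `Φ₀(S₀) ≅ ℕ`, `hFinv`
unconditional). [cite: MochizukiEtTh2009, Cor 3.8 p.80] -/
theorem cor38_i_ii_ofRankOnePointR (h : Cor38Hyp (ofRankOnePointR hZ P hpf R S) (ofRankOnePointR hZ' P' hpf' R' S'))
    (hE : ∀ (Y : (isConnectedGSet (G := G)).FullSubcategory)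
      (b : Algebra.GrothendieckGroup
        ((RealifiedDivisorMonoids.realDataWeak (DivisorMonoids.ofGaloisActionConnected A hZ) hpf).rlf.obj (op Y)))
      (x : (hpf (op Y)).weak.Rlf),
      b ∈ ((RealifiedDivisorMonoids.realDataWeak (DivisorMonoids.ofGaloisActionConnected A hZ) hpf).realSpan
        (DivisorMonoids.ofGaloisActionConnected A hZ).biratGp).carrier Y →
      b = Algebra.GrothendieckGroup.of x →
      b ∈ ((RealifiedDivisorMonoids.realDataWeak (DivisorMonoids.ofGaloisActionConnected A hZ) hpf).realSpan
        (DivisorMonoids.ofGaloisActionConnected A hZ).cnstGp).carrier Y)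
    (hE' : ∀ (Y : (isConnectedGSet (G := G')).FullSubcategory)
      (b : Algebra.GrothendieckGroup
        ((RealifiedDivisorMonoids.realDataWeak (DivisorMonoids.ofGaloisActionConnected A' hZ') hpf').rlf.obj (op Y)))
      (x : (hpf' (op Y)).weak.Rlf),
      b ∈ ((RealifiedDivisorMonoids.realDataWeak (DivisorMonoids.ofGaloisActionConnected A' hZ') hpf').realSpan
        (DivisorMonoids.ofGaloisActionConnected A' hZ').biratGp).carrier Y →
      b = Algebra.GrothendieckGroup.of x →
      b ∈ ((RealifiedDivisorMonoids.realDataWeak (DivisorMonoids.ofGaloisActionConnected A' hZ') hpf').realSpan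
        (DivisorMonoids.ofGaloisActionConnected A' hZ').cnstGp).carrier Y) :
    Literature.AnabelianGeometry.EtaleTheta.Cor38_i
        (fun E _ => Literature.AlgebraicGeometry.Frobenioids.IsFrobeniusSlim E) h ∧
      Literature.AnabelianGeometry.EtaleTheta.Cor38_ii
        (fun E _ Φ => ∀ (B : E) (α : Aut (Over.forget B)),
          (∀ (B' : Over B) (x : Φ.obj (op B'.left)),
            Literature.AlgebraicGeometry.Frobenioids.pull Φ (α.hom.app B') x = x) → α = 1) h := by
  have hF := isFrobenioid_ofRlfRWeak_ofGaloisActionConnected_of_isOfFSMType A hZ hpf (ofRankOnePointR hZ P hpf R S)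
    PadicFrd.isOfFSMType_discretePUnit
  have hF' := isFrobenioid_ofRlfRWeak_ofGaloisActionConnected_of_isOfFSMType A' hZ' hpf' (ofRankOnePointR hZ' P' hpf' R' S')
    PadicFrd.isOfFSMType_discretePUnit
  exact ⟨h.cor38_i_weak_of_coord hF hF' (hP34Λ_ofGaloisActionConnected_weakR A hZ hpf hE)
      (exists_cnstFn_effective_ofRankOnePointR hZ P hpf R S) (hQ_ofRankOnePointR hZ P hpf R S)
      (hP34Λ_ofGaloisActionConnected_weakR A' hZ' hpf' hE') (exists_cnstFn_effective_ofRankOnePointR hZ' P' hpf' R' S')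
      (hQ_ofRankOnePointR hZ' P' hpf' R' S'),
    h.cor38_ii_weak_of_coord hF hF' (hP34Λ_ofGaloisActionConnected_weakR A hZ hpf hE)
      (exists_cnstFn_effective_ofRankOnePointR hZ P hpf R S) (hQ_ofRankOnePointR hZ P hpf R S)
      (RealifiedDivisorMonoids.ofRlfRWeak_hFinv' _ hpf)
      (hP34Λ_ofGaloisActionConnected_weakR A' hZ' hpf' hE') (exists_cnstFn_effective_ofRankOnePointR hZ' P' hpf' R' S')
      (hQ_ofRankOnePointR hZ' P' hpf' R' S') (RealifiedDivisorMonoids.ofRlfRWeak_hFinv' _ hpf')⟩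

end RankOnePairR

end TemperedFrobenioid

namespace OneCompFrd

variable (U : Type) [CommGroup U] (hU : ∀ u : U, (∀ N : ℕ+, ∃ g : U, g ^ (N : ℕ) = u) → u = 1)

/-- **`Φ₀^birat ⊆ Φ₀^cnst` at EVERY connected covering of the one-component model** (all log-meromorphic functions are constant:
`F₀(Y) = B₀(Y)`). [cite: MochizukiEtTh2009, Def 3.3 p.73] -/
theorem biratGp_le_cnstGp_dm (Y : D₀) : (dm U hU).biratGp.carrier Y ≤ (dm U hU).cnstGp.carrier Y :=
  Subgroup.closure_mono (by
    rintro _ ⟨b, rfl⟩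
    exact ⟨b, fun _ => trivial, rfl⟩)

/-- **The `Λ = ℝ` effective-locus clause `hE` of [EtTh] Prop. 3.4 (ii) (census A2, GAP G-w5d130-1) HOLDS at the one-component data** —
even without the effectivity premise: `ℝ·Φ₀^birat = ℝ·Φ₀^cnst` at every connected covering (spans are monotone).
[cite: MochizukiEtTh2009, Prop 3.4 (ii) p.74] -/
theorem effRealSpan_dm (Y : D₀)
    (b : Algebra.GrothendieckGroup ((RealifiedDivisorMonoids.realDataWeak (dm U hU) (hpfCof_oneComp U hU)).rlf.obj (op Y)))
    (x : (hpfCof_oneComp U hU (op Y)).weak.Rlf)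
    (hb : b ∈ ((RealifiedDivisorMonoids.realDataWeak (dm U hU) (hpfCof_oneComp U hU)).realSpan (dm U hU).biratGp).carrier Y)
    (_hbx : b = Algebra.GrothendieckGroup.of x) :
    b ∈ ((RealifiedDivisorMonoids.realDataWeak (dm U hU) (hpfCof_oneComp U hU)).realSpan (dm U hU).cnstGp).carrier Y :=
  RealificationDataLemmas.realSpan_mono _ Y (biratGp_le_cnstGp_dm U hU Y) hb

variable (R S R' S' : ((Discrete PUnit.{1})ᵒᵖ ⥤ CommMonCat.{0}) → Prop)

/-- **[EtTh] Cor. 3.8 (i) ∧ (ii) AS TYPED, monoid type `ℝ`, with NO binder beyond `h` at the one-component model's `ℝ`-witness**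
(abc-iut-w6-d048's `OneCompFrd.temperedFrobenioidR U hU R S`): `cor38_i_ii_ofRankOnePointR` with `hE` DISCHARGED (`effRealSpan_dm`).
[cite: MochizukiEtTh2009, Cor 3.8 p.80] -/
theorem cor38_i_ii_temperedFrobenioidR (h : Cor38Hyp (temperedFrobenioidR U hU R S) (temperedFrobenioidR U hU R' S')) :
    Literature.AnabelianGeometry.EtaleTheta.Cor38_i
        (fun E _ => Literature.AlgebraicGeometry.Frobenioids.IsFrobeniusSlim E) h ∧
      Literature.AnabelianGeometry.EtaleTheta.Cor38_ii
        (fun E _ Φ => ∀ (B : E) (α : Aut (Over.forget B)),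
          (∀ (B' : Over B) (x : Φ.obj (op B'.left)),
            Literature.AlgebraicGeometry.Frobenioids.pull Φ (α.hom.app B') x = x) → α = 1) h :=
  TemperedFrobenioid.cor38_i_ii_ofRankOnePointR _ _ _ R S _ _ _ R' S' h
    (fun Y b x hb hbx => effRealSpan_dm U hU Y b x hb hbx) (fun Y b x hb hbx => effRealSpan_dm U hU Y b x hb hbx)

/-- **The CONCLUSIONS of Cor. 3.8 (i) and (ii), monoid type `ℝ`, at the one-component model, for every `h`** (slim and Div-slim
one-object base). [cite: MochizukiEtTh2009, Cor 3.8 p.81] -/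
theorem cor38_i_ii_conclusion_temperedFrobenioidR
    (h : Cor38Hyp (temperedFrobenioidR U hU R S) (temperedFrobenioidR U hU R' S')) :
    PreservesBaseFieldTheoretic h ∧
      ∃ Ψbs : (temperedFrobenioidR U hU R S).hullCategory ≌ (temperedFrobenioidR U hU R' S').hullCategory,
        Nonempty ((temperedFrobenioidR U hU R S).hull ⋙ h.Ψ.functor ≅ Ψbs.functor ⋙ (temperedFrobenioidR U hU R' S').hull) :=
  (cor38_i_ii_temperedFrobenioidR U hU R S R' S' h).2 (Toy.isDivSlim45iv_discretePUnit _) (Toy.isDivSlim45iv_discretePUnit _)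

end OneCompFrd

namespace TateTowerFrd

variable (R S R' S' : ((Discrete PUnit.{1})ᵒᵖ ⥤ CommMonCat.{0}) → Prop)

/-- **[EtTh] Cor. 3.8 (i) ∧ (ii) AS TYPED, monoid type `ℝ`, at the MODEL OF RECORD's `ℝ`-witness** (abc-iut-w6-d048's
`TateTowerFrd.temperedFrobenioidR`), residual = the tower's `Λ = ℝ` effective-locus clause `hE` ONLY (census A2; the same binder as
abc-iut-w6-d061's `thm37_ofRankOnePointR_of_inputs`). [cite: MochizukiEtTh2009, Cor 3.8 p.80] -/
theorem cor38_i_ii_temperedFrobenioidR (h : Cor38Hyp (temperedFrobenioidR R S) (temperedFrobenioidR R' S'))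
    (hE : ∀ (Y : (isConnectedGSet (G := Multiplicative ℤ)).FullSubcategory)
      (b : Algebra.GrothendieckGroup ((RealifiedDivisorMonoids.realDataWeak dm hpf).rlf.obj (op Y)))
      (x : (hpf (op Y)).weak.Rlf),
      b ∈ ((RealifiedDivisorMonoids.realDataWeak dm hpf).realSpan dm.biratGp).carrier Y →
      b = Algebra.GrothendieckGroup.of x →
      b ∈ ((RealifiedDivisorMonoids.realDataWeak dm hpf).realSpan dm.cnstGp).carrier Y) :
    Literature.AnabelianGeometry.EtaleTheta.Cor38_i
        (fun E _ => Literature.AlgebraicGeometry.Frobenioids.IsFrobeniusSlim E) h ∧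
      Literature.AnabelianGeometry.EtaleTheta.Cor38_ii
        (fun E _ Φ => ∀ (B : E) (α : Aut (Over.forget B)),
          (∀ (B' : Over B) (x : Φ.obj (op B'.left)),
            Literature.AlgebraicGeometry.Frobenioids.pull Φ (α.hom.app B') x = x) → α = 1) h :=
  TemperedFrobenioid.cor38_i_ii_ofRankOnePointR _ _ _ R S _ _ _ R' S' h hE hE

end TateTowerFrd

end Literature.AnabelianGeometry.EtaleTheta

end
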